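import Mathlib.RingTheory.Valuation.LocalSubring
import Mathlib.FieldTheory.IsAlgClosed.Basic
import Mathlib.Algebra.Algebra.Subalgebra.Directed
import Mathlib.Algebra.Polynomial.Reverse
import HarnessLib

/-!
# Rational places: an extension `L/F` of an algebraically closed field has a valuation ring with
# residue field `F`

Topic `RingTheory/Valuation`. We prove the classical extension theorem for places in the form
needed by the valuation arguments of additive combinatorics in field extensions
(`Literature.Combinatorics.Additive.LinearVosperProofs`, Bachoc–Serra–Zémor 2017, §7):

* `exists_valuationSubring_forall_sub_algebraMap_lt` — if `F` is algebraically closed and `L` is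
  any field extension of `F`, there is a valuation subring `O` of `L` containing `F` such that
  every element of `O` is congruent to an element of `F` modulo the maximal ideal of `O`
  (i.e. the residue field of `O` is `F`, an "`F`-rational place" of `L/F`).

This is Chevalley's extension theorem for homomorphisms into an algebraically closed field
(Atiyah–Macdonald, *Introduction to Commutative Algebra*, Lemma 5.19–Theorem 5.21; Lang,
*Algebra*, VII §3; Zariski–Samuel II, VI §4 Thm 5) specialised to the identity `F → F`:
a pair `(B, g)` consisting of an `F`-subalgebra `B ⊆ L` and an `F`-algebra map `g : B → F`,
maximal among such pairs for extension, is a valuation ring of `L` whose maximal ideal is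
`ker g`; since `g` restricts to the identity on `F`, the residue field is `F`.

Mathlib (`Mathlib.RingTheory.Valuation.LocalSubring`) has Chevalley's theorem in the form
"local subrings maximal for domination are valuation rings" (stacks 00IA/00IB), which does not
control the residue field; we re-run its argument (`Algebra.mem_ideal_map_adjoin`,
`Algebra.exists_aeval_invOf_eq_zero_of_idealMap_adjoin_sup_span_eq_top`, lying over) for pairs
`(B, g)`.  The maximality of `(B, g)` is carried as the explicit hypothesis `hmax` below rather
than through a bespoke order structure.

## Proof architecture (Atiyah–Macdonald 5.19–5.21)

* `mem_of_maximal_of_surjective` — the one use of maximality: if `S ⊇ B` is a `B`-subalgebra of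
  `L` and `Q` a prime of `S` containing `ker g` with `F → S/Q` onto, then `S = B`.
* `surjective_algebraMap_quotient_adjoin` — for `S = B[x]`, `F → S/Q` is onto as soon as the
  class of `x` is a scalar.
* `inv_mem_of_maximal` — `B` is local with maximal ideal `ker g` (AM 5.19, proved without
  localisation: `ker g · B[y⁻¹]` is a proper ideal when `g y ≠ 0`).
* `mem_of_maximal_of_isIntegral` — `B` is integrally closed in `L` (lying over + a root in the
  domain `S/Q` of a monic polynomial over the algebraically closed `F` is a scalar).
* `mem_or_inv_mem_of_maximal` — `B` is a valuation ring (AM 5.20–5.21, via Mathlib's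
  `Algebra.exists_aeval_invOf_eq_zero_of_idealMap_adjoin_sup_span_eq_top`).
* `exists_maximal_pair` — Zorn (`Subalgebra.iSupLift` glues a chain).
-/

noncomputable section

open Polynomial

namespace Literature.RingTheory.Valuation

variable {F L : Type*} [Field F] [Field L] [Algebra F L]

section MaximalPair

variable (B : Subalgebra F L) (g : B →ₐ[F] F)

/-- For an `F`-algebra map `g : B → F` on an `F`-subalgebra `B ⊆ L`, every `b ∈ B` is congruent
to the scalar `g b` modulo `ker g`. [folklore] -/
theorem sub_algebraMap_mem_ker (b : B) : b - algebraMap F B (g b) ∈ RingHom.ker g := by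
  rw [RingHom.mem_ker, map_sub, AlgHom.commutes, Algebra.algebraMap_self_apply, sub_self]

/-- If an ideal `Q` of a `B`-subalgebra `S ⊆ L` contains `ker g`, then `B → S/Q` factors through
`g : B → F` followed by the structure map `F → S/Q`. [folklore] -/
theorem algebraMap_quotient_eq_comp (S : Subalgebra B L) (Q : Ideal S)
    (hker : ∀ b : B, g b = 0 → algebraMap B S b ∈ Q) :
    algebraMap B (S ⧸ Q) = (algebraMap F (S ⧸ Q)).comp (g : B →+* F) := by
  ext b
  rw [RingHom.comp_apply, IsScalarTower.algebraMap_apply B S (S ⧸ Q),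
    IsScalarTower.algebraMap_apply F S (S ⧸ Q), Ideal.Quotient.algebraMap_eq, RingHom.coe_coe,
    Ideal.Quotient.eq, IsScalarTower.algebraMap_apply F B S, ← map_sub]
  exact hker _ (sub_algebraMap_mem_ker B g b)

/-- Pointwise form of `algebraMap_quotient_eq_comp`: the class of `b ∈ B` in `S/Q` is the scalar
`g b`. [folklore] -/
theorem mk_algebraMap_eq (S : Subalgebra B L) (Q : Ideal S)
    (hker : ∀ b : B, g b = 0 → algebraMap B S b ∈ Q) (b : B) :
    Ideal.Quotient.mk Q (algebraMap B S b) = algebraMap F (S ⧸ Q) (g b) := by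
  rw [← Ideal.Quotient.algebraMap_eq, ← IsScalarTower.algebraMap_apply,
    algebraMap_quotient_eq_comp B g S Q hker]
  rfl

/-- For `S = B[x]` and an ideal `Q ⊇ ker g` of `S`: if the class of `x` in `S/Q` is a scalar,
then `F → S/Q` is onto (every element of `S` is a polynomial in `x` over `B`, and `B` maps into
the scalars). [folklore] -/
theorem surjective_algebraMap_quotient_adjoin (x : L) (Q : Ideal (Algebra.adjoin B {x}))
    (hker : ∀ b : B, g b = 0 → algebraMap B (Algebra.adjoin B {x}) b ∈ Q)
    (hx : ∃ c₀ : F, Ideal.Quotient.mk Q ⟨x, Algebra.self_mem_adjoin_singleton B x⟩ =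
      algebraMap F _ c₀) :
    Function.Surjective (algebraMap F (Algebra.adjoin B {x} ⧸ Q)) := by
  intro q
  obtain ⟨s, rfl⟩ := Ideal.Quotient.mk_surjective q
  obtain ⟨p, hp⟩ := Algebra.adjoin_eq_exists_aeval B x s
  obtain ⟨c₀, hc₀⟩ := hx
  set xS : Algebra.adjoin B {x} := ⟨x, Algebra.self_mem_adjoin_singleton B x⟩ with hxS
  have hs : s = aeval xS p := by
    apply Subtype.ext
    rw [← hp]
    exact (Polynomial.aeval_subalgebra_coe p (Algebra.adjoin B {x}) xS).symm
  have h1 : Ideal.Quotient.mk Q (aeval xS p) = aeval (Ideal.Quotient.mk Q xS) p := by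
    rw [← Ideal.Quotient.mkₐ_eq_mk B, Polynomial.aeval_algHom_apply]
  refine ⟨p.eval₂ (g : B →+* F) c₀, ?_⟩
  rw [hs, h1, hc₀, Polynomial.aeval_def, algebraMap_quotient_eq_comp B g _ Q hker,
    Polynomial.hom_eval₂]

/-- **The one use of maximality** (Atiyah–Macdonald, proof of Thm 5.21): let `(B, g)` be maximal.
If `S ⊇ B` is a subalgebra of `L`, `Q` a prime ideal of `S` containing `ker g`, and the structure
map `F → S/Q` is onto, then `g` extends to `S` (as `S → S/Q ≅ F`), so `S = B`. [folklore] -/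
theorem mem_of_maximal_of_surjective
    (hmax : ∀ (S : Subalgebra F L) (g' : S →ₐ[F] F) (h : B ≤ S),
      (∀ x : B, g' (Subalgebra.inclusion h x) = g x) → S ≤ B)
    (S : Subalgebra B L) (Q : Ideal S) (hQ : Q.IsPrime)
    (hker : ∀ b : B, g b = 0 → algebraMap B S b ∈ Q)
    (hsurj : Function.Surjective (algebraMap F (S ⧸ Q))) {x : L} (hx : x ∈ S) : x ∈ B := by
  have hbij : Function.Bijective (algebraMap F (S ⧸ Q)) :=
    ⟨(algebraMap F (S ⧸ Q)).injective, hsurj⟩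
  let e : F ≃+* S ⧸ Q := RingEquiv.ofBijective _ hbij
  have he : ∀ c : F, e c = algebraMap F (S ⧸ Q) c := fun c => rfl
  let φ : S →+* F := e.symm.toRingHom.comp (Ideal.Quotient.mk Q)
  have hφ : ∀ s : S, algebraMap F (S ⧸ Q) (φ s) = Ideal.Quotient.mk Q s := fun s => by
    rw [← he]
    simp [φ]
  have hφc : ∀ c : F, φ (algebraMap F S c) = c := fun c => by
    apply hbij.1
    rw [hφ, ← Ideal.Quotient.mk_algebraMap]
  let g' : (S.restrictScalars F) →ₐ[F] F :=
    { φ with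
      commutes' := fun c => by
        change φ (algebraMap F S c) = algebraMap F F c
        rw [hφc]
        rfl }
  have hBS : B ≤ S.restrictScalars F := fun b hb => S.algebraMap_mem (⟨b, hb⟩ : B)
  have hext : ∀ y : B, g' (Subalgebra.inclusion hBS y) = g y := fun y => by
    have h1 : Subalgebra.inclusion hBS y = algebraMap B S y := Subtype.ext rfl
    change φ (Subalgebra.inclusion hBS y) = g y
    apply hbij.1
    rw [hφ, h1, mk_algebraMap_eq B g S Q hker]
  exact hmax (S.restrictScalars F) g' hBS hext hx

/-- If all coefficients of `q ∈ B[X]` lie in `ker g`, then `q` maps to `0` under `g`.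
[folklore] -/
theorem eval₂_eq_zero_of_coeff_mem_ker (q : B[X]) (hq : ∀ i, q.coeff i ∈ RingHom.ker g)
    (c : F) : q.eval₂ (g : B →+* F) c = 0 := by
  rw [Polynomial.eval₂_eq_sum_range]
  refine Finset.sum_eq_zero fun i _ => ?_
  rw [RingHom.coe_coe, RingHom.mem_ker.mp (hq i), zero_mul]

/-- **`B` is local with maximal ideal `ker g`** (Atiyah–Macdonald, Lemma 5.19), for a maximal
pair `(B, g)`: if `y ∈ B` and `g y ≠ 0` then `y⁻¹ ∈ B`. Proof without localisation: the ideal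
`ker g · B[y⁻¹]` is proper (an identity `1 = ∑ kᵢ y⁻ⁱ` with `kᵢ ∈ ker g` gives, after
multiplying by `yⁿ` and applying `g`, `g(y)ⁿ = 0`), and modulo a maximal ideal above it `y⁻¹`
is the scalar `g(y)⁻¹`. [folklore] -/
theorem inv_mem_of_maximal
    (hmax : ∀ (S : Subalgebra F L) (g' : S →ₐ[F] F) (h : B ≤ S),
      (∀ x : B, g' (Subalgebra.inclusion h x) = g x) → S ≤ B)
    {y : L} (hy : y ∈ B) (hgy : g ⟨y, hy⟩ ≠ 0) : y⁻¹ ∈ B := by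
  have hy0 : y ≠ 0 := by
    rintro rfl
    exact hgy (by rw [show (⟨(0 : L), hy⟩ : B) = 0 from rfl, map_zero])
  set S : Subalgebra B L := Algebra.adjoin B {y⁻¹} with hS_def
  set I : Ideal S := (RingHom.ker g).map (algebraMap B S) with hI_def
  have hyS : y ∈ S := S.algebraMap_mem (⟨y, hy⟩ : B)
  -- `I` is a proper ideal
  have hI : I ≠ ⊤ := by
    intro htop
    have h1 : (1 : S) ∈ I := htop ▸ Submodule.mem_top
    obtain ⟨p, hp, hp1⟩ := (Algebra.mem_ideal_map_adjoin y⁻¹ (RingHom.ker g)).mp h1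
    rw [Polynomial.aeval_def, OneMemClass.coe_one] at hp1
    letI : Invertible y⁻¹ := invertibleOfNonzero (inv_ne_zero hy0)
    have key := Polynomial.eval₂_reverse_mul_pow (algebraMap B L) y⁻¹ p
    rw [invOf_eq_inv, inv_inv, hp1] at key
    -- `key : eval₂ (algebraMap B L) y p.reverse * y⁻¹ ^ p.natDegree = 1`
    have key2 : eval₂ (algebraMap B L) y p.reverse = y ^ p.natDegree := by
      have h := congrArg (· * y ^ p.natDegree) key
      simpa only [mul_assoc, inv_pow, inv_mul_cancel₀ (pow_ne_zero _ hy0), mul_one,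
        one_mul] using h
    have key3 : p.reverse.eval (⟨y, hy⟩ : B) = ⟨y, hy⟩ ^ p.natDegree := by
      apply Subtype.val_injective
      rw [SubmonoidClass.coe_pow]
      change algebraMap B L (p.reverse.eval ⟨y, hy⟩) = y ^ p.natDegree
      rw [← key2, ← Polynomial.eval₂_at_apply]
      rfl
    have key5 : (g : B →+* F) (p.reverse.eval ⟨y, hy⟩) = 0 := by
      rw [← Polynomial.eval₂_at_apply]
      exact eval₂_eq_zero_of_coeff_mem_ker B g _ (fun i => by rw [coeff_reverse]; exact hp _) _
    rw [RingHom.coe_coe, key3, map_pow] at key5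
    exact hgy (pow_eq_zero_iff'.mp key5).1
  obtain ⟨M, hM, hIM⟩ := Ideal.exists_le_maximal I hI
  have hkerM : ∀ b : B, g b = 0 → algebraMap B S b ∈ M := fun b hb =>
    hIM (Ideal.mem_map_of_mem _ (RingHom.mem_ker.mpr hb))
  refine mem_of_maximal_of_surjective B g hmax S M hM.isPrime hkerM ?_
    (Algebra.self_mem_adjoin_singleton B y⁻¹)
  refine surjective_algebraMap_quotient_adjoin B g y⁻¹ M hkerM ⟨(g ⟨y, hy⟩)⁻¹, ?_⟩
  -- the class of `y` is the scalar `g y`, so the class of `y⁻¹` is `(g y)⁻¹`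
  set yS : S := ⟨y, hyS⟩ with hyS_def
  set zS : S := ⟨y⁻¹, Algebra.self_mem_adjoin_singleton B y⁻¹⟩ with hzS_def
  have hyq : Ideal.Quotient.mk M yS = algebraMap F (S ⧸ M) (g ⟨y, hy⟩) := by
    have h1 : yS = algebraMap B S ⟨y, hy⟩ := Subtype.ext rfl
    rw [h1]
    exact mk_algebraMap_eq B g S M hkerM _
  have hprod : yS * zS = 1 := Subtype.ext (mul_inv_cancel₀ hy0)
  have h2 : algebraMap F (S ⧸ M) (g ⟨y, hy⟩) * Ideal.Quotient.mk M zS = 1 := by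
    rw [← hyq, ← map_mul, hprod, map_one]
  have h3 : algebraMap F (S ⧸ M) (g ⟨y, hy⟩)⁻¹ *
      (algebraMap F (S ⧸ M) (g ⟨y, hy⟩) * Ideal.Quotient.mk M zS) =
      algebraMap F (S ⧸ M) (g ⟨y, hy⟩)⁻¹ := by
    rw [h2, mul_one]
  rw [← mul_assoc, ← map_mul, inv_mul_cancel₀ hgy, map_one, one_mul] at h3
  exact h3

/-- A root, in a domain `A` over an algebraically closed field `K`, of a monic polynomial over
`K` is a scalar (its minimal polynomial is irreducible, hence linear). [folklore] -/
theorem exists_algebraMap_eq_of_isIntegral {K A : Type*} [Field K] [IsAlgClosed K] [CommRing A]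
    [IsDomain A] [Algebra K A] {z : A} (hz : IsIntegral K z) : ∃ c : K, algebraMap K A c = z := by
  have hq : (minpoly K z).leadingCoeff = 1 := minpoly.monic hz
  have h : (minpoly K z).degree = 1 :=
    IsAlgClosed.degree_eq_one_of_irreducible K (minpoly.irreducible hz)
  have h0 : aeval z (minpoly K z) = 0 := minpoly.aeval K z
  rw [Polynomial.eq_X_add_C_of_degree_eq_one h, hq, C_1, one_mul, aeval_add, aeval_X, aeval_C,
    add_eq_zero_iff_eq_neg] at h0
  exact ⟨-(minpoly K z).coeff 0, by rw [map_neg]; exact h0.symm⟩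

/-- **`B` is integrally closed in `L`** for a maximal pair `(B, g)` with `F` algebraically
closed (Atiyah–Macdonald, proof of Thm 5.21 / stacks 00IC for pairs): an element `x ∈ L`
integral over `B` lies in `B`. Indeed `B[x]` is integral over `B`, so a maximal ideal `Q` of
`B[x]` lies over the maximal ideal `ker g`; in the domain `B[x]/Q` the class of `x` is a root
of a monic polynomial over `F`, hence a scalar, so `F → B[x]/Q` is onto and maximality gives
`B[x] = B`. [folklore] -/
theorem mem_of_maximal_of_isIntegral [IsAlgClosed F]
    (hmax : ∀ (S : Subalgebra F L) (g' : S →ₐ[F] F) (h : B ≤ S),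
      (∀ x : B, g' (Subalgebra.inclusion h x) = g x) → S ≤ B)
    {x : L} (hx : IsIntegral B x) : x ∈ B := by
  set S : Subalgebra B L := Algebra.adjoin B {x} with hS_def
  haveI : Algebra.IsIntegral B S := Algebra.IsIntegral.adjoin (by simpa using hx)
  have hgsurj : Function.Surjective g := fun c => ⟨algebraMap F B c, AlgHom.commutes g c⟩
  haveI hmaxI : (RingHom.ker g).IsMaximal := RingHom.ker_isMaximal_of_surjective g hgsurj
  obtain ⟨Q, hQ, hQc⟩ := Ideal.exists_ideal_over_maximal_of_isIntegral (S := S) (RingHom.ker g)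
    (fun b hb => by
      rw [RingHom.mem_ker] at hb ⊢
      have hb0 : (b : L) = 0 := congrArg Subtype.val hb
      rw [show b = 0 from Subtype.ext hb0, map_zero])
  have hkerQ : ∀ b : B, g b = 0 → algebraMap B S b ∈ Q := fun b hb => by
    have : b ∈ Q.comap (algebraMap B S) := by
      rw [hQc]
      exact RingHom.mem_ker.mpr hb
    exact Ideal.mem_comap.mp this
  refine mem_of_maximal_of_surjective B g hmax S Q hQ.isPrime hkerQ ?_
    (Algebra.self_mem_adjoin_singleton B x)
  refine surjective_algebraMap_quotient_adjoin B g x Q hkerQ ?_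
  haveI := hQ.isPrime
  set xS : S := ⟨x, Algebra.self_mem_adjoin_singleton B x⟩ with hxS_def
  obtain ⟨p, hp, hpx⟩ := hx
  have hz : IsIntegral F (Ideal.Quotient.mk Q xS) := by
    refine ⟨p.map (g : B →+* F), hp.map _, ?_⟩
    have h0 : aeval xS p = 0 := Subtype.ext (by
      rw [Polynomial.aeval_subalgebra_coe p S xS, ZeroMemClass.coe_zero, Polynomial.aeval_def]
      exact hpx)
    rw [Polynomial.eval₂_map, ← algebraMap_quotient_eq_comp B g S Q hkerQ,
      ← Polynomial.aeval_def, ← Ideal.Quotient.mkₐ_eq_mk B, Polynomial.aeval_algHom_apply, h0,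
      map_zero]
  obtain ⟨c, hc⟩ := exists_algebraMap_eq_of_isIntegral hz
  exact ⟨c, hc.symm⟩

/-- **A maximal pair is a valuation ring** (Atiyah–Macdonald, Thm 5.21; Chevalley): for a
maximal pair `(B, g)` with `F` algebraically closed and every `x ∈ L`, `x ∈ B` or `x⁻¹ ∈ B`.
As in Mathlib's `LocalSubring.exists_valuationRing_of_isMax`: if `x ∉ B` then
`ker g · B[x] + (x) = B[x]` (otherwise, modulo a maximal ideal containing it, `x ≡ 0` is a scalar
and maximality forces `x ∈ B`), whence `x⁻¹` is a root of a polynomial over `B` whose leading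
coefficient is `≡ 1 (mod ker g)`, hence a unit (`inv_mem_of_maximal`); so `x⁻¹` is integral
over `B` and `mem_of_maximal_of_isIntegral` applies. [folklore] -/
theorem mem_or_inv_mem_of_maximal [IsAlgClosed F]
    (hmax : ∀ (S : Subalgebra F L) (g' : S →ₐ[F] F) (h : B ≤ S),
      (∀ x : B, g' (Subalgebra.inclusion h x) = g x) → S ≤ B)
    (x : L) : x ∈ B ∨ x⁻¹ ∈ B := by
  refine or_iff_not_imp_left.mpr fun hx => ?_
  have hx0 : x ≠ 0 := fun e => hx (e ▸ zero_mem B)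
  letI := invertibleOfNonzero hx0
  set S : Subalgebra B L := Algebra.adjoin B {x} with hS_def
  have htop : (RingHom.ker g).map (algebraMap B S) ⊔
      Ideal.span {(⟨x, Algebra.subset_adjoin rfl⟩ : S)} = ⊤ := by
    by_contra hne
    obtain ⟨M, hM, hJM⟩ := Ideal.exists_le_maximal _ hne
    have hkerM : ∀ b : B, g b = 0 → algebraMap B S b ∈ M := fun b hb =>
      hJM (Ideal.mem_sup_left (Ideal.mem_map_of_mem _ (RingHom.mem_ker.mpr hb)))
    have hxM : (⟨x, Algebra.subset_adjoin rfl⟩ : S) ∈ M :=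
      hJM (Ideal.mem_sup_right (Ideal.subset_span rfl))
    refine hx (mem_of_maximal_of_surjective B g hmax S M hM.isPrime hkerM ?_
      (Algebra.self_mem_adjoin_singleton B x))
    refine surjective_algebraMap_quotient_adjoin B g x M hkerM ⟨0, ?_⟩
    rw [map_zero]
    exact Ideal.Quotient.eq_zero_iff_mem.mpr hxM
  obtain ⟨p, hp, hpx⟩ := Algebra.exists_aeval_invOf_eq_zero_of_idealMap_adjoin_sup_span_eq_top
    x _ (RingHom.ker_ne_top g) htop
  have hlc : g p.leadingCoeff = 1 := by
    have := RingHom.mem_ker.mp hp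
    rwa [map_sub, map_one, sub_eq_zero] at this
  have hne : ((p.leadingCoeff : B) : L) ≠ 0 := by
    intro h0
    rw [show p.leadingCoeff = 0 from Subtype.ext h0, map_zero] at hlc
    exact zero_ne_one hlc
  have hunit : IsUnit p.leadingCoeff := by
    have hmem : ((p.leadingCoeff : B) : L)⁻¹ ∈ B :=
      inv_mem_of_maximal B g hmax (p.leadingCoeff).2 (by rw [Subtype.coe_eta, hlc]; exact one_ne_zero)
    exact isUnit_iff_exists_inv.mpr ⟨⟨_, hmem⟩, Subtype.ext (mul_inv_cancel₀ hne)⟩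
  rw [Polynomial.aeval_def, invOf_eq_inv] at hpx
  have hint : IsIntegral B x⁻¹ :=
    ⟨C (hunit.unit⁻¹).1 * p, by simp [Polynomial.Monic], by simpa using Or.inr hpx⟩
  exact mem_of_maximal_of_isIntegral B g hmax hint

end MaximalPair

/-- **Zorn step**: there is a pair `(B, g)` — an `F`-subalgebra `B ⊆ L` with an `F`-algebra map
`g : B → F` — admitting no proper extension `(S, g')`, `B < S`, `g'|_B = g`
(Atiyah–Macdonald, p. 65, the set `Σ` of pairs; chains are glued by `Subalgebra.iSupLift`).
[folklore] -/
theorem exists_maximal_pair :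
    ∃ (B : Subalgebra F L) (g : B →ₐ[F] F), ∀ (S : Subalgebra F L) (g' : S →ₐ[F] F)
      (h : B ≤ S), (∀ x : B, g' (Subalgebra.inclusion h x) = g x) → S ≤ B := by
  let P := Σ B : Subalgebra F L, (B →ₐ[F] F)
  let r : P → P → Prop := fun p q =>
    ∃ h : p.1 ≤ q.1, ∀ x : p.1, q.2 (Subalgebra.inclusion h x) = p.2 x
  have hrefl : ∀ a : P, r a a := fun a => ⟨le_rfl, fun x => rfl⟩
  have htrans : ∀ {a b c : P}, r a b → r b c → r a c := by
    intro a b c ⟨hab, hab'⟩ ⟨hbc, hbc'⟩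
    refine ⟨hab.trans hbc, fun x => ?_⟩
    rw [← hab' x, ← hbc' (Subalgebra.inclusion hab x)]
    rfl
  have hchain : ∀ c : Set P, IsChain r c → ∃ ub, ∀ a ∈ c, r a ub := by
    intro c hc
    rcases c.eq_empty_or_nonempty with rfl | hne
    · exact ⟨⟨⊥, (Algebra.botEquivOfInjective (algebraMap F L).injective).toAlgHom⟩,
        fun a ha => (Set.notMem_empty a ha).elim⟩
    haveI : Nonempty c := hne.to_subtype
    have hK : ∀ i j : c, r i.1 j.1 ∨ r j.1 i.1 := fun i j => by
      by_cases hij : i.1 = j.1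
      · left
        rw [hij]
        exact hrefl _
      · exact hc i.2 j.2 hij
    have hdir : Directed (· ≤ ·) (fun i : c => i.1.1) := by
      intro i j
      rcases hK i j with ⟨h, -⟩ | ⟨h, -⟩
      exacts [⟨j, h, le_rfl⟩, ⟨i, le_rfl, h⟩]
    have hf : ∀ (i j : c) (h : i.1.1 ≤ j.1.1),
        i.1.2 = (j.1.2).comp (Subalgebra.inclusion h) := by
      intro i j h
      ext x
      rcases hK i j with ⟨h', e⟩ | ⟨h', e⟩
      · exact (e x).symm
      · rw [AlgHom.comp_apply, ← e (Subalgebra.inclusion h x)]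
        rfl
    refine ⟨⟨iSup (fun i : c => i.1.1), Subalgebra.iSupLift (fun i : c => i.1.1) hdir
      (fun i => i.1.2) hf _ le_rfl⟩, fun a ha => ?_⟩
    refine ⟨le_iSup (fun i : c => i.1.1) ⟨a, ha⟩, fun x => ?_⟩
    exact Subalgebra.iSupLift_inclusion (K := fun i : c => i.1.1) (dir := hdir)
      (f := fun i => i.1.2) (hf := hf) (T := iSup fun i : c => i.1.1) (hT := le_rfl)
      (i := ⟨a, ha⟩) x (le_iSup (fun i : c => i.1.1) ⟨a, ha⟩)
  obtain ⟨⟨B, g⟩, hm⟩ := exists_maximal_of_chains_bounded hchain htrans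
  refine ⟨B, g, fun S g' h hext => ?_⟩
  obtain ⟨h', -⟩ := hm ⟨S, g'⟩ ⟨h, hext⟩
  exact h'

/-- **`F`-rational places exist** (Chevalley's extension theorem for places into an
algebraically closed field; Atiyah–Macdonald Thm 5.21 with Lemma 5.19, Lang *Algebra* VII §3
Cor. 3.3): if `F` is algebraically closed and `L/F` is any field extension, there is a valuation
subring `O` of `L` containing `F` whose residue field is `F`, i.e. every `b ∈ O` satisfies
`v(b - c) < 1` for some scalar `c ∈ F`. (For `L ≠ F` the valuation is automatically non-trivial:
an element of `L ∖ F` or its inverse lies in `O` and is congruent to a scalar.) [folklore] -/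
theorem exists_valuationSubring_forall_sub_algebraMap_lt [IsAlgClosed F] :
    ∃ O : ValuationSubring L, (∀ c : F, algebraMap F L c ∈ O) ∧
      ∀ b ∈ O, ∃ c : F, O.valuation (b - algebraMap F L c) < 1 := by
  obtain ⟨B, g, hmax⟩ := exists_maximal_pair (F := F) (L := L)
  let O : ValuationSubring L := ⟨B.toSubring, mem_or_inv_mem_of_maximal B g hmax⟩
  have hOB : ∀ x, x ∈ O ↔ x ∈ B := fun x => Iff.rfl
  refine ⟨O, fun c => (hOB _).mpr (B.algebraMap_mem c), fun b hb => ⟨g ⟨b, hb⟩, ?_⟩⟩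
  have hd : b - algebraMap F L (g ⟨b, hb⟩) ∈ B := sub_mem hb (B.algebraMap_mem _)
  have hgd : g ⟨_, hd⟩ = 0 := by
    have : (⟨_, hd⟩ : B) = ⟨b, hb⟩ - algebraMap F B (g ⟨b, hb⟩) := Subtype.ext rfl
    rw [this]
    exact RingHom.mem_ker.mp (sub_algebraMap_mem_ker B g ⟨b, hb⟩)
  refine lt_of_le_of_ne (O.valuation_le_one ⟨_, hd⟩) fun heq => ?_
  obtain ⟨u, hu⟩ := isUnit_iff_exists_inv.mp ((O.valuation_eq_one_iff ⟨_, hd⟩).mpr heq)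
  have h1 : (⟨_, hd⟩ : B) * ⟨(u : L), u.2⟩ = 1 := Subtype.ext (congrArg Subtype.val hu)
  have h2 := congrArg g h1
  rw [map_mul, hgd, zero_mul, map_one] at h2
  exact zero_ne_one h2

end Literature.RingTheory.Valuation
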